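import Mathlib
import Summits.Ventures.PercRepro2.SwOutCrossBaseMark
import Summits.Ventures.PercRepro2.SwOutCrossBaseTypeM

/-!
# The cross base, for ANY cross graph: the type lemma with the mark anywhere but at `u` or a
dropped vertex (blind cell PercRepro2, night-4 g25, 2026-08-28; proofs/NIGHT4-G25.md §3)

`SwOutCrossBaseMark` §MarkType re-stated on the minimal record `fibKEEMin G`
(`conn_blue_anti_markM`, `mem_tgtU_of_betterFM_mark`); `conn_mono_mark` is reused.
-/

namespace Summit.Ventures.PercRepro2

namespace CrossArm

open Hull LocRows

variable {V E : Type*}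

open scoped Classical

section MarkType

variable {ends : E → Sym2 V} {σ : Config E} {h u : V} {ι X κ : Type*} {U : ι → Set V}
  {p : X → V} {G : SimpleGraph X} {F : κ → Set V} [Fintype X] [DecidableEq X]
  [DecidableRel G.Adj] [Nonempty X] (hb : CrossBase ends σ h u U p G F)
include hb

omit [Fintype X] [DecidableEq X] [DecidableRel G.Adj] [Nonempty X] in
/-- **Blue connection is antitone in the type, the mark anywhere but at `u`, `p i`.** -/
theorem CrossBase.conn_blue_anti_markM (hup : ∀ i, ∃ e, ends e = s(u, p i))
    (hcross : ∀ i j, G.Adj i j → ∃ e, ends e = s(p i, p j)) {x x' : PtXG ι κ X G}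
    (hx'B : ¬ LeakBX G x')
    (hord : BetterFM (fibKEEMin G) (typFM (fibKEEMin G) (toGen G x'))
      (typFM (fibKEEMin G) (toGen G x)))
    {l o : V} (hl : l ∉ strX h u U p F) (hou : o ≠ u) (hop : ∀ i, o ≠ p i)
    (hlh : ¬ Conn ends (blue (crossReal ends u U p G F σ x')) l h)
    (hlo : Conn ends (blue (crossReal ends u U p G F σ x')) l o) :
    Conn ends (blue (crossReal ends u U p G F σ x)) l o := by
  rw [hb.blue_crossReal] at hlh hlo ⊢
  obtain ⟨hfar, harm, hext, hlink, -⟩ := betterFM_iff.1 (betterFM_flip hord)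
  exact hb.dual.conn_mono_mark hup hcross hx'B harm hfar hext
    (fun i m hi hm hr => (hlink i m ⟨hi, hm, hr⟩).2.2) hl hou hop hlh hlo

omit [Fintype X] [DecidableEq X] [DecidableRel G.Adj] [Nonempty X] in
/-- **THE TYPE LEMMA, the mark anywhere but at `u`, `p i`.** For non-leaking points `x ≤ x'`,
`l` outside the structure and `o ≠ u`, `o ≠ p i`: if the realisation of `x` lies in the
pulled-back conditioning `tgtU l h {S | o ∈ S}`, so does the realisation of `x'`. -/
theorem CrossBase.mem_tgtU_of_betterFM_mark [Fintype E] [DecidableEq E]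
    (hup : ∀ i, ∃ e, ends e = s(u, p i))
    (hcross : ∀ i j, G.Adj i j → ∃ e, ends e = s(p i, p j)) {x x' : PtXG ι κ X G}
    (hxR : ¬ LeakRX G x) (hx'R : ¬ LeakRX G x') (hx'B : ¬ LeakBX G x')
    (hord : BetterFM (fibKEEMin G) (typFM (fibKEEMin G) (toGen G x'))
      (typFM (fibKEEMin G) (toGen G x)))
    {l o : V} (hl : l ∉ strX h u U p F) (hou : o ≠ u) (hop : ∀ i, o ≠ p i)
    (hx : crossReal ends u U p G F σ x ∈ tgtU ends l h {S | o ∈ S}) :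
    crossReal ends u U p G F σ x' ∈ tgtU ends l h {S | o ∈ S} := by
  simp only [tgtU, Finset.mem_filter, Finset.mem_univ, true_and, Set.mem_setOf_eq,
    mem_cluster] at hx ⊢
  obtain ⟨hxh, hxo, hxb⟩ := hx
  obtain ⟨hfar, harm, hext, hlink, -⟩ := betterFM_iff.1 hord
  have hlh : ¬ Conn ends (crossReal ends u U p G F σ x) l h := fun hc => hxh (Or.inl hc)
  have h1 : h ∉ hull ends (crossReal ends u U p G F σ x') l := by
    intro hh
    have hlh' : l ∈ hull ends (crossReal ends u U p G F σ x') h := by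
      rcases hh with hh | hh
      · exact Or.inl (conn_symm hh)
      · exact Or.inr (conn_symm hh)
    exact hl (hb.hull_crossReal_subset hup hcross hx'R hx'B hlh')
  refine ⟨h1, ?_, ?_⟩
  · exact hb.conn_mono_mark hup hcross hxR harm hfar hext
      (fun i m hi hm hr => (hlink i m ⟨hi, hm, hr⟩).2.2) hl hou hop hlh hxo
  · intro hc
    exact hxb (hb.conn_blue_anti_markM hup hcross hx'B hord hl hou hop
      (fun hc' => h1 (Or.inr hc')) hc)

end MarkType

end CrossArm

end Summit.Ventures.PercRepro2
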